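import Literature.Computability.AlgebraicComplexity.PlethysmHookVanishing
import Literature.Computability.Complexity.OccurrenceObstructionsIPProofs
import Literature.Computability.Complexity.PlethysmStabilityBIP
import HarnessLib

/-!
# Ikenmeyer–Panova 2017, Thm. 1.7(a) discharged: the six exceptional bodies do not occur in
# `Sym^d Sym^m V`; IP Thm. 1.4 from Prop. 2.8 and Thm. 4.6 only

Sibling proofs file (D-0014) of `Literature/Computability/Complexity/OccurrenceObstructionsIP.lean`,
conventions as there (permanent size `n`, determinant size = inner degree `m`, outer degree `d`,
`V = ℂ^{m²}` with the lexicographic matrix variables `MatIdx m`, `a_λ(d[m]) =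
plethysmCoeff ℂ (MatIdx m) m (partitionWeightLex m λ)`, body `λ̄ = body λ`, IP's exceptional set
`𝔛 = ipExceptionalBodies = {(1), (1,1), (1⁴), (1⁶), (2,1), (3,1)}`). Theorems only.

1. **`ikenmeyerPanova2017_thm_1_7a_holds`** discharges the named fact
   `Literature.Computability.Complexity.ikenmeyerPanova2017_thm_1_7a` — C. Ikenmeyer, G. Panova,
   Adv. Math. 319 (2017), Thm. 1.7(a) (held arXiv text: Thm. 7(a)): "Let `d ∈ ℕ`, `n ∈ ℕ`,
   `λ ⊢ dn`. (a) If `λ̄ ∈ 𝔛`, then `a_λ(d[n]) = 0`." In print this is "a finite calculation reveals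
   `a_{λ̄} = 0`" (limit rectangular Kronecker coefficients) combined with IP Prop. 2.8; here it is
   proved DIRECTLY and for all `d`, `m`: by
   `Literature/Computability/AlgebraicComplexity/PlethysmHookVanishing.lean`, `Sym^d Sym^m V` has no
   highest-weight vector of weight `λ` whenever `λ` is a hook `(L, 1^j)`, `j ≥ 1`, or of the form
   `(L, 2, 1^j)`, `(L, 3, 1^j)`, `j ≥ 1` (the wreath symmetrisation of every polytabloid of such a
   shape vanishes by a block-swap cancellation), and the six bodies of `𝔛` are of this form
   (`shape_of_mem_ipExceptionalBodies`). The general statement is `plethysmCoeff_eq_zero_of_shape`.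
2. **Consequences.** With Thm. 1.7(a) and the transposition property
   (`OccurrenceObstructionsIPProofs.lean`) now theorems, IP Thm. 1.4 for IP's padded permanent
   (`ikenmeyerPanova2017_thm_1_4`, the corrected form of the tree fact
   `ikenmeyer_panova_rectangular_kronecker_pos`) rests on exactly TWO named facts of IP's paper:
   Prop. 2.8 (inequality of multiplicities: Manivel's stability of rectangular Kronecker
   coefficients + the Kadish–Landsberg lifting + Peter–Weyl + finiteness of determinantal
   complexity) and Thm. 4.6 (main Kronecker positivity: semigroup property, Bessenrodt–Behns square
   positivity, and the hook base cases computed in `S_49`) — for every permanent size `n ≥ 1`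
   outside the window `n = 2`, `48 < m < 243` (`ikenmeyerPanova2017_thm_1_4_of_prop_2_8_of_thm_4_6`;
   verbatim for `n ≥ 3`, `…_three_le`), and so do the two fresh-variable statements the printed
   parts deliver (`kroneckerCoeff_pos_paddedPerOrbitRep_of_prop_2_8_of_thm_4_6`, threshold
   `3·max(n²+1, 9)² ≤ m`; `…'`, threshold `3(n+1)^4 < m`).

## References

* C. Ikenmeyer, G. Panova, *Rectangular Kronecker coefficients and plethysms in geometric
  complexity theory*, Adv. Math. 319 (2017) 40–66 = arXiv:1512.03798: Thm. 1.7(a) and §4 ("Proof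
  of Thm. 1.7": "If `λ̄ ∈ 𝔛`, a finite calculation reveals `a_{λ̄} = 0`. Combining this with
  Prop. 2.8 gives `a_λ(d[n]) = 0`"), Thm. 1.4 and §1.1 (its proof, held p. 5).
  [key `IkenmeyerPanova2017`]
* P. Bürgisser, C. Ikenmeyer, G. Panova, J. AMS 32 (2019) = arXiv:1604.06431v3, Prop. 3.3,
  Lemma 4.3, (4.1) (the word model of the plethysm). [key `BurgisserIkenmeyerPanovaJAMS2019`]
-/

open scoped BigOperators

namespace Literature.Computability.Complexity

open Literature.NumberTheory.DiophantineGeometry (highestWeightSpace Weight)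

/-! ### The shapes of the six exceptional bodies -/

section ShapeData

variable {D : ℕ}

/-- The decreasing sort of a constant multiset is the constant list. [folklore] -/
theorem sort_replicate_ge (n a : ℕ) :
    (Multiset.replicate n a).sort (· ≥ ·) = List.replicate n a := by
  induction n with
  | zero => simp
  | succ n ih =>
    rw [Multiset.replicate_succ, Multiset.sort_cons, ih, List.replicate_succ]
    intro b hb
    rw [Multiset.eq_of_mem_replicate hb]

/-- Sorted parts and number of parts of a partition from the decreasing sort `L ≠ []` of its body:
`λ = (λ₁, L)` and `ℓ(λ) = |L| + 1`. [cite: IkenmeyerPanova2017, §1.1 (the body `λ̄`)] -/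
theorem sortedParts_eq_cons_of_body (lam : Nat.Partition D) {L : List ℕ}
    (hL : (body lam).sort (· ≥ ·) = L) (hL0 : L ≠ []) :
    lam.sortedParts = lam.parts.sup :: L ∧ lam.parts.card = L.length + 1 := by
  have h0 : lam.parts ≠ 0 := by
    intro h0
    apply hL0
    rw [← hL, body, h0, Multiset.erase_zero, Multiset.sort_zero]
  refine ⟨by rw [sortedParts_eq_cons lam h0, ← hL]; rfl, ?_⟩
  rw [← hL, Multiset.length_sort, body, Multiset.card_erase_add_one (sup_mem_of_ne_zero h0)]

/-- The shape hypotheses of `PlethysmHookVanishing.lean` for a partition `λ = (a, L)` read off the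
list `L` of its lower rows: rows `≥ 2` of length `≤ 1` (so all cells outside column `0` lie in rows
`≤ 1`), at least two rows, `λ₂ ≤ ℓ(λ)`, and `λ₂ ≤ 1` or `ℓ(λ) ≥ 3`. [folklore] -/
theorem shape_of_sortedParts (lam : Nat.Partition D) {a : ℕ} {L : List ℕ}
    (hs : lam.sortedParts = a :: L) (hcard : lam.parts.card = L.length + 1)
    (hL1 : L.getD 1 0 ≤ 1) (hlen : 1 ≤ L.length) (hL0 : L.getD 0 0 ≤ L.length + 1)
    (hL0' : L.getD 0 0 ≤ 1 ∨ 2 ≤ L.length) :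
    (∀ c ∈ lam.youngDiagram.cells, c.2 ≠ 0 → c.1 ≤ 1) ∧ 2 ≤ lam.parts.card ∧
      lam.sortedParts.getD 1 0 ≤ lam.parts.card ∧
      (lam.sortedParts.getD 1 0 ≤ 1 ∨ 3 ≤ lam.parts.card) := by
  have hg1 : lam.sortedParts.getD 1 0 = L.getD 0 0 := by rw [hs, List.getD_cons_succ]
  have hg2 : lam.sortedParts.getD 2 0 = L.getD 1 0 := by rw [hs, List.getD_cons_succ]
  refine ⟨?_, by omega, by rw [hg1]; omega, by rw [hg1]; rcases hL0' with h | h <;> omega⟩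
  intro c hc hc2
  by_contra hlt
  push Not at hlt
  have hmem : (c.1, c.2) ∈ lam.youngDiagram := (YoungDiagram.mem_cells _).1 hc
  rw [YoungDiagram.mem_iff_lt_rowLen] at hmem
  have hanti := lam.youngDiagram.rowLen_anti 2 c.1 (by omega)
  rw [Literature.NumberTheory.DiophantineGeometry.rowLen_youngDiagram lam 2, hg2] at hanti
  omega

/-- **The six exceptional bodies are hook-like.** If `λ̄ ∈ 𝔛 = {(1), (1,1), (1⁴), (1⁶), (2,1),
(3,1)}` then `λ` is a hook `(L, 1^j)` (`j ∈ {1, 2, 4, 6}`) or `(L, 2, 1)` or `(L, 3, 1)`, hence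
satisfies the shape hypotheses of `CplxAlg.eq_zero_of_mem_highestWeightSpace_coordRep_of_shape`:
cells outside column `0` in rows `≤ 1`, `ℓ(λ) ≥ 2`, `λ₂ ≤ ℓ(λ)`, and `λ₂ ≤ 1` or `ℓ(λ) ≥ 3`.
[cite: IkenmeyerPanova2017, Thm. 1.7 (the set 𝔛; held: Thm. 7)] -/
theorem shape_of_mem_ipExceptionalBodies (lam : Nat.Partition D)
    (hX : body lam ∈ ipExceptionalBodies) :
    (∀ c ∈ lam.youngDiagram.cells, c.2 ≠ 0 → c.1 ≤ 1) ∧ 2 ≤ lam.parts.card ∧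
      lam.sortedParts.getD 1 0 ≤ lam.parts.card ∧
      (lam.sortedParts.getD 1 0 ≤ 1 ∨ 3 ≤ lam.parts.card) := by
  -- hooks: body `1^j`, `j ≥ 1`
  have hook : ∀ j, 1 ≤ j → body lam = Multiset.replicate j 1 →
      (∀ c ∈ lam.youngDiagram.cells, c.2 ≠ 0 → c.1 ≤ 1) ∧ 2 ≤ lam.parts.card ∧
        lam.sortedParts.getD 1 0 ≤ lam.parts.card ∧
        (lam.sortedParts.getD 1 0 ≤ 1 ∨ 3 ≤ lam.parts.card) := by
    intro j hj hB
    obtain ⟨hs, hcard⟩ := sortedParts_eq_cons_of_body lam (L := List.replicate j 1)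
      (by rw [hB, sort_replicate_ge]) (by
        obtain ⟨j', rfl⟩ : ∃ j', j = j' + 1 := ⟨j - 1, by omega⟩
        rw [List.replicate_succ]; exact List.cons_ne_nil _ _)
    have hget : ∀ i, (List.replicate j 1).getD i 0 ≤ 1 := fun i => by
      rw [List.getD_eq_getElem?_getD, List.getElem?_replicate]
      split_ifs <;> simp
    refine shape_of_sortedParts lam hs hcard (hget 1) (by rw [List.length_replicate]; exact hj)
      ((hget 0).trans (by omega)) (Or.inl (hget 0))
  rcases (mem_ipExceptionalBodies_iff _).mp hX with h | h | h | h | h | h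
  · exact hook 1 le_rfl (by rw [h, Multiset.replicate_one])
  · exact hook 2 (by norm_num) h
  · exact hook 4 (by norm_num) h
  · exact hook 6 (by norm_num) h
  · -- body `(2, 1)`
    obtain ⟨hs, hcard⟩ := sortedParts_eq_cons_of_body lam (L := [2, 1]) (by
      rw [h, Multiset.insert_eq_cons, Multiset.sort_cons, Multiset.sort_singleton]
      intro b hb
      rw [Multiset.mem_singleton] at hb
      omega) (List.cons_ne_nil _ _)
    exact shape_of_sortedParts lam hs hcard (by decide) (by decide) (by decide) (Or.inr (by decide))
  · -- body `(3, 1)`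
    obtain ⟨hs, hcard⟩ := sortedParts_eq_cons_of_body lam (L := [3, 1]) (by
      rw [h, Multiset.insert_eq_cons, Multiset.sort_cons, Multiset.sort_singleton]
      intro b hb
      rw [Multiset.mem_singleton] at hb
      omega) (List.cons_ne_nil _ _)
    exact shape_of_sortedParts lam hs hcard (by decide) (by decide) (by decide) (Or.inr (by decide))

end ShapeData

/-! ### IP Thm. 1.7(a) is a theorem -/

section Discharge

open Literature.NumberTheory.DiophantineGeometry (MatIdx plethysmCoeff hwMultiplicity)

/-- **No plethysm highest-weight vectors of hook-like weight** (all `d`, `m`): for `λ ⊢ m·d` with at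
most `m²` parts, at least two parts, cells outside column `0` in rows `≤ 1`, `λ₂ ≤ ℓ(λ)` and
`λ₂ ≤ 1` or `ℓ(λ) ≥ 3` — the hooks `(L, 1^j)`, `j ≥ 1`, and `(L, 2, 1^j)`, `(L, 3, 1^j)`, `j ≥ 1` —
the plethysm coefficient `a_λ(d[m])` (multiplicity of the weight `λ^*` in `ℂ[Sym^m V^*]`,
`V = ℂ^{m²}`) vanishes: a highest-weight vector of that weight is a form of degree `d` (a weight
pins the degree) and is killed by `CplxAlg.eq_zero_of_mem_highestWeightSpace_coordRep_of_shape`.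
[cite: IkenmeyerPanova2017, Thm. 1.7(a) (held: Thm. 7(a)); direct proof, all hook-like shapes] -/
theorem plethysmCoeff_eq_zero_of_shape {m d : ℕ} [NeZero m] (lam : Nat.Partition (m * d))
    (hlam : lam.parts.card ≤ m * m)
    (h1 : ∀ c ∈ lam.youngDiagram.cells, c.2 ≠ 0 → c.1 ≤ 1) (h2 : 2 ≤ lam.parts.card)
    (h3 : lam.sortedParts.getD 1 0 ≤ lam.parts.card)
    (h4 : lam.sortedParts.getD 1 0 ≤ 1 ∨ 3 ≤ lam.parts.card) :
    plethysmCoeff ℂ (MatIdx m) m (partitionWeightLex m lam) = 0 := by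
  classical
  -- transport `λ` to `Nat.Partition (d * m)`, the size of the word model of `V^{⊗ d m}`
  let lam' : Nat.Partition (d * m) := ⟨lam.parts, lam.parts_pos, by rw [lam.parts_sum, mul_comm]⟩
  have hw : partitionWeightLex m lam' = partitionWeightLex m lam := rfl
  rw [plethysmCoeff, hwMultiplicity]
  suffices H : highestWeightSpace (AlgebraicComplexity.coordRep (MatIdx m) ℂ m)
      (partitionWeightLex m lam) = ⊥ by
    rw [H, finrank_bot]
  rw [Submodule.eq_bot_iff]
  intro h hh
  rw [← hw] at hh
  have hhom : h.IsHomogeneous d :=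
    AlgebraicComplexity.isHomogeneous_of_mem_highestWeightSpace (NeZero.ne m) hh
      (size_partitionWeightLex lam' hlam)
  exact AlgebraicComplexity.eq_zero_of_mem_highestWeightSpace_coordRep_of_shape
    (strictAnti_revMatIdx m) lam' hlam h1 h2 h3 h4 hhom (neg_partitionWeightLex_revMatIdx m lam') hh

/-- **Discharge of `ikenmeyerPanova2017_thm_1_7a` — IP Thm. 1.7(a) (held: Thm. 7(a)).** "Let
`d ∈ ℕ`, `n ∈ ℕ`, `λ ⊢ dn`. (a) If `λ̄ ∈ 𝔛`, then `a_λ(d[n]) = 0`", `𝔛 = {(1), (1,1), (1⁴), (1⁶),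
(2,1), (3,1)}`: the six bodies are hook-like (`shape_of_mem_ipExceptionalBodies`) and hook-like
shapes have no plethysm highest-weight vectors (`plethysmCoeff_eq_zero_of_shape`). IP deduce this
from the finite calculation `a_{λ̄} = 0` and Prop. 2.8; the direct proof needs neither.
[cite: IkenmeyerPanova2017, Thm. 1.7(a) (held: Thm. 7(a))] -/
theorem ikenmeyerPanova2017_thm_1_7a_holds : ikenmeyerPanova2017_thm_1_7a := by
  intro m d _ lam hlam hX
  obtain ⟨h1, h2, h3, h4⟩ := shape_of_mem_ipExceptionalBodies lam hX
  exact plethysmCoeff_eq_zero_of_shape lam hlam h1 h2 h3 h4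

end Discharge

/-! ### IP Thm. 1.4 from the two remaining facts: Prop. 2.8 and Thm. 4.6 -/

section TwoFacts

/-- **IP Thm. 1.4 (`ikenmeyerPanova2017_thm_1_4`, IP's padding, threshold `3n^4 < m`) from Prop. 2.8
and Thm. 4.6 only**, for every permanent size `0 < n` outside the window `n = 2`, `48 < m < 243`
(Thm. 1.7(a), the transposition property, Kadish–Landsberg and the BLMW lift being theorems of the
tree). [cite: IkenmeyerPanova2017, Thm. 1.4 (held: Thm. 4) and §1.1 (Proof of Thm. 1.4; held p. 5)] -/
theorem ikenmeyerPanova2017_thm_1_4_of_prop_2_8_of_thm_4_6 (h28 : ikenmeyerPanova2017_prop_2_8)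
    (h46 : ikenmeyerPanova2017_thm_4_6)
    {n m d : ℕ} [NeZero m] (hn0 : 0 < n) (hnm : 3 * n ^ 4 < m) (h2 : n = 2 → 243 ≤ m)
    (lam : Nat.Partition (m * d)) (hlam : lam.parts.card ≤ m * m)
    (h : Literature.NumberTheory.DiophantineGeometry.HasHighestWeight
      (Complexity.bipPaddedPerOrbitRep ℂ n m) (partitionWeightLex m lam)) :
    0 < Literature.NumberTheory.DiophantineGeometry.kroneckerCoeff ℂ lam (Nat.Partition.rectangle m d)
      (Nat.Partition.rectangle m d) :=
  ikenmeyerPanova2017_thm_1_4_of_three_facts h28 ikenmeyerPanova2017_thm_1_7a_holds h46 hn0 hnm h2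
    lam hlam h

/-- **IP Thm. 1.4 verbatim for permanent size `n ≥ 3` from Prop. 2.8 and Thm. 4.6 only**: once
these two named facts are discharged, this is `ikenmeyerPanova2017_thm_1_4` restricted to `3 ≤ n`,
the range of the printed proof.
[cite: IkenmeyerPanova2017, Thm. 1.4 (held: Thm. 4) and §1.1 (Proof of Thm. 1.4; held p. 5)] -/
theorem ikenmeyerPanova2017_thm_1_4_of_prop_2_8_of_thm_4_6_three_le
    (h28 : ikenmeyerPanova2017_prop_2_8) (h46 : ikenmeyerPanova2017_thm_4_6) :
    ∀ (n m d : ℕ) [NeZero m] (_hn : 3 ≤ n) (_hnm : 3 * n ^ 4 < m)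
      (lam : Nat.Partition (m * d)) (_hlam : lam.parts.card ≤ m * m)
      (_h : Literature.NumberTheory.DiophantineGeometry.HasHighestWeight
        (Complexity.bipPaddedPerOrbitRep ℂ n m) (partitionWeightLex m lam)),
      0 < Literature.NumberTheory.DiophantineGeometry.kroneckerCoeff ℂ lam
        (Nat.Partition.rectangle m d) (Nat.Partition.rectangle m d) :=
  ikenmeyerPanova2017_thm_1_4_of_three_facts_three_le h28 ikenmeyerPanova2017_thm_1_7a_holds h46

/-- **IP Thm. 1.4 at threshold `3·max(n², 9)² ≤ m` for every `n ≥ 1`, from Prop. 2.8 and Thm. 4.6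
only** (Thm. 4.6 invoked directly). [cite: IkenmeyerPanova2017, Thm. 1.4 (held: Thm. 4), via Prop. 2.8 and Thm. 4.6] -/
theorem ikenmeyerPanova2017_thm_1_4_of_prop_2_8_of_thm_4_6_max (h28 : ikenmeyerPanova2017_prop_2_8)
    (h46 : ikenmeyerPanova2017_thm_4_6)
    {n m d : ℕ} [NeZero m] (hn0 : 0 < n) (hnm : 3 * (max (n ^ 2) 9) ^ 2 ≤ m)
    (lam : Nat.Partition (m * d)) (hlam : lam.parts.card ≤ m * m)
    (h : Literature.NumberTheory.DiophantineGeometry.HasHighestWeight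
      (Complexity.bipPaddedPerOrbitRep ℂ n m) (partitionWeightLex m lam)) :
    0 < Literature.NumberTheory.DiophantineGeometry.kroneckerCoeff ℂ lam (Nat.Partition.rectangle m d)
      (Nat.Partition.rectangle m d) :=
  ikenmeyerPanova2017_thm_1_4_of_three_facts_max h28 ikenmeyerPanova2017_thm_1_7a_holds h46 hn0 hnm
    lam hlam h

/-- **Fresh-variable padding (the orbit closure of the tree fact
`ikenmeyer_panova_rectangular_kronecker_pos`) at threshold `3·max(n²+1, 9)² ≤ m`, from Prop. 2.8 and
Thm. 4.6 only.** Not a printed statement (IP's chain run with `ℓ = max(n²+1, 9)`); the tree fact's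
threshold `3n^4 < m` is not reached by the printed parts.
[cite: IkenmeyerPanova2017, §4 (Proof of Thm. 1.7; held p. 12) and §1.1 (Proof of Thm. 1.4), with ℓ = max(n² + 1, 9)] -/
theorem kroneckerCoeff_pos_paddedPerOrbitRep_of_prop_2_8_of_thm_4_6
    (h28 : ikenmeyerPanova2017_prop_2_8) (h46 : ikenmeyerPanova2017_thm_4_6)
    {n m d : ℕ} [NeZero m] (hnm : 3 * (max (n ^ 2 + 1) 9) ^ 2 ≤ m)
    (lam : Nat.Partition (m * d)) (hlam : lam.parts.card ≤ m * m)
    (h : Literature.NumberTheory.DiophantineGeometry.HasHighestWeight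
      (Literature.NumberTheory.DiophantineGeometry.paddedPerOrbitRep ℂ n m)
      (partitionWeightLex m lam)) :
    0 < Literature.NumberTheory.DiophantineGeometry.kroneckerCoeff ℂ lam (Nat.Partition.rectangle m d)
      (Nat.Partition.rectangle m d) :=
  kroneckerCoeff_pos_paddedPerOrbitRep_of_three_facts h28 ikenmeyerPanova2017_thm_1_7a_holds h46 hnm
    lam hlam h

/-- **Fresh-variable padding at threshold `3(n+1)^4 < m` (`2 ≤ n`), from Prop. 2.8 and Thm. 4.6
only** (IP's proof with parameter `M = n + 1`). Not a printed statement.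
[cite: IkenmeyerPanova2017, §1.1 (Proof of Thm. 1.4; held p. 5), with M = n + 1] -/
theorem kroneckerCoeff_pos_paddedPerOrbitRep_of_prop_2_8_of_thm_4_6'
    (h28 : ikenmeyerPanova2017_prop_2_8) (h46 : ikenmeyerPanova2017_thm_4_6)
    {n m d : ℕ} [NeZero m] (hn : 2 ≤ n) (hnm : 3 * (n + 1) ^ 4 < m) (lam : Nat.Partition (m * d))
    (hlam : lam.parts.card ≤ m * m)
    (h : Literature.NumberTheory.DiophantineGeometry.HasHighestWeight
      (Literature.NumberTheory.DiophantineGeometry.paddedPerOrbitRep ℂ n m)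
      (partitionWeightLex m lam)) :
    0 < Literature.NumberTheory.DiophantineGeometry.kroneckerCoeff ℂ lam (Nat.Partition.rectangle m d)
      (Nat.Partition.rectangle m d) :=
  kroneckerCoeff_pos_paddedPerOrbitRep_of_three_facts' h28 ikenmeyerPanova2017_thm_1_7a_holds h46 hn
    hnm lam hlam h

/-- **The padding-free core with Thm. 1.7(a) discharged**: for `M ≥ 3`, `3M^4 < m`, a partition
`λ ⊢ m·d` with at most `m²` parts, `ℓ(λ) ≤ M²`, `|λ̄| ≤ M d`, occurring in `ℂ[Sym^m V^*]`, one has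
`g(λ, m×d, m×d) > 0` — from Cor. 1.6 and Thm. 1.7(b) (IP's "Proof of Thm. 1.4" verbatim,
`kroneckerCoeff_pos_of_parts`). [cite: IkenmeyerPanova2017, §1.1 (Proof of Thm. 1.4; held: Proof of Thm. 4, p. 5)] -/
theorem kroneckerCoeff_pos_of_cor_1_6_of_thm_1_7b (h16 : ikenmeyerPanova2017_cor_1_6)
    (h17b : ikenmeyerPanova2017_thm_1_7b)
    {m d M : ℕ} [NeZero m] (hM : 3 ≤ M) (hMm : 3 * M ^ 4 < m) (lam : Nat.Partition (m * d))
    (hlam : lam.parts.card ≤ m * m) (hℓ : lam.parts.card ≤ M ^ 2) (hbody : bodySize lam ≤ M * d)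
    (hocc : Literature.NumberTheory.DiophantineGeometry.HasHighestWeight
      (AlgebraicComplexity.coordRep (Literature.NumberTheory.DiophantineGeometry.MatIdx m) ℂ m)
      (partitionWeightLex m lam)) :
    0 < Literature.NumberTheory.DiophantineGeometry.kroneckerCoeff ℂ lam (Nat.Partition.rectangle m d)
      (Nat.Partition.rectangle m d) :=
  kroneckerCoeff_pos_of_parts h16 ikenmeyerPanova2017_thm_1_7a_holds h17b hM hMm lam hlam hℓ hbody hocc

end TwoFacts

/-! ### Corollary: `h_d[h_m]` contains no hook shapes besides `(dm)` -/

section Hooks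

open Literature.NumberTheory.DiophantineGeometry (MatIdx plethysmCoeff)

/-- A partition whose body is a column `1^j`, `j ≥ 1` — a hook `(L, 1^j)` — satisfies the shape
hypotheses of `plethysmCoeff_eq_zero_of_shape`. [folklore] -/
theorem shape_of_body_eq_replicate {D : ℕ} (lam : Nat.Partition D) {j : ℕ} (hj : 1 ≤ j)
    (hB : body lam = Multiset.replicate j 1) :
    (∀ c ∈ lam.youngDiagram.cells, c.2 ≠ 0 → c.1 ≤ 1) ∧ 2 ≤ lam.parts.card ∧
      lam.sortedParts.getD 1 0 ≤ lam.parts.card ∧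
      (lam.sortedParts.getD 1 0 ≤ 1 ∨ 3 ≤ lam.parts.card) := by
  obtain ⟨hs, hcard⟩ := sortedParts_eq_cons_of_body lam (L := List.replicate j 1)
    (by rw [hB, sort_replicate_ge]) (by
      obtain ⟨j', rfl⟩ : ∃ j', j = j' + 1 := ⟨j - 1, by omega⟩
      rw [List.replicate_succ]; exact List.cons_ne_nil _ _)
  have hget : ∀ i, (List.replicate j 1).getD i 0 ≤ 1 := fun i => by
    rw [List.getD_eq_getElem?_getD, List.getElem?_replicate]
    split_ifs <;> simp
  exact shape_of_sortedParts lam hs hcard (hget 1) (by rw [List.length_replicate]; exact hj)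
    ((hget 0).trans (by omega)) (Or.inl (hget 0))

/-- **No hooks in `Sym^d Sym^m V`.** For every hook `λ = (dm - j, 1^j) ⊢ m·d` with `j ≥ 1` (body
`λ̄ = 1^j`) and at most `m²` parts, the plethysm coefficient `a_λ(d[m])` — the multiplicity of the
weight `λ^*` in `ℂ[Sym^m V^*]`, `V = ℂ^{m²}` — vanishes: the classical fact that `h_d[h_m]`
contains no Schur function of hook shape other than `s_{(dm)}`, here from the block-swap
cancellation of `PlethysmHookVanishing.lean`. [folklore] -/
theorem plethysmCoeff_eq_zero_of_body_eq_replicate {m d : ℕ} [NeZero m]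
    (lam : Nat.Partition (m * d)) (hlam : lam.parts.card ≤ m * m) {j : ℕ} (hj : 1 ≤ j)
    (hB : body lam = Multiset.replicate j 1) :
    plethysmCoeff ℂ (MatIdx m) m (partitionWeightLex m lam) = 0 := by
  obtain ⟨h1, h2, h3, h4⟩ := shape_of_body_eq_replicate lam hj hB
  exact plethysmCoeff_eq_zero_of_shape lam hlam h1 h2 h3 h4

end Hooks

end Literature.Computability.Complexity
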